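import Literature.AlgebraicGeometry.ComplexMultiplication.AndreRiemannBiproducts
import Literature.AlgebraicGeometry.Milne1999.SpecialLefschetzGroupInvariantsCMType
import Literature.AlgebraicGeometry.HodgeTheory.HodgeConjectureAbelianSubquotients
import Literature.AlgebraicGeometry.Pohlmann1968.SimpleCMAbelianFourfoldPowers
import Literature.AlgebraicGeometry.ComplexMultiplication.QuadraticCMFieldPairwiseForeignFamiliesHodge
import Literature.AlgebraicGeometry.ComplexMultiplication.ImaginaryQuadraticTimesQuarticCMHodge
import Literature.AlgebraicGeometry.ComplexMultiplication.QuadraticCMFieldTwoSlotFamilies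
import Literature.AlgebraicGeometry.ComplexMultiplication.TwoSimpleCMSurfacesHodge
import Literature.AlgebraicGeometry.ComplexMultiplication.QuadraticCMFieldFamiliesSeparating
import HarnessLib

/-!
# Moonen–Zarhin 1999 Thm. 0.1 (4), CM case, on CM types: simple, pairwise non-isogenous CM abelian varieties of total
# dimension `≤ 4` outside case (a) form a nondegenerate family — `B = D` on all their products; Milne's regrouping
# `A₁^{r₁} × ⋯ × A_s^{r_s} → X` with simple pairwise non-isogenous representatives; `B = D` descends along dominations

(Part 1) Every complex abelian variety `X` of CM type of positive dimension admits an isogeny `⨁_i A'_{cls i} → X` from a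
biproduct of SIMPLE, PAIRWISE NON-ISOGENOUS CM realisations `A'_c` (Milne, Duke 1999 Prop. 1.1 regrouped), of total
dimension `Σ_c dim A'_c ≤ dim X`; every power `X^{N+1}` is then an isogeny factor of a product of copies of the `A'_c`
(`exists_avDominatedBy_powSucc_biproduct_slots`), and `B = D` descends along a domination `s ≫ π = [N]_A`
(`isDivisorGenerated_of_avDominatedBy`). (Part 2) Degree/dimension bookkeeping `Σ_i [K_i:ℚ] = 2 Σ_i dim A_i`.
(Part 3) No imaginary quadratic field embeds in a quartic CM field carrying a primitive type; the MAIN CRITERION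
`isNondegenerateFamily_iff_of_isSimple_of_sum_dim_le_four`: for simple, pairwise non-isogenous CM realisations of total
dimension `≤ 4`, the family of their CM types is nondegenerate iff NOT case (a) (no curve field `K_a` embedding in a sextic
`K_b`), whence `Bᵐ ⊗ ℂ = Dᵐ ⊗ ℂ` on every `∏_i A_i^{k_i}` outside case (a)
(`hodgeClassSpan_prod_eq_divisorClassesSpan_of_sum_dim_le_four`), and conversely case (a) places a rational `(2,2)`-class
outside `D² ⊗ ℂ` on every product containing the curve and the threefold (`exists_exceptional_two_prod_of_dim_one_dim_three_of_ringHom`).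

* Part 1 — from `CorCM/CMAbelianVarietyDimLeThreePowers` (5/21 declarations; namespace
  `Literature.AlgebraicGeometry.ComplexMultiplication`): Complex abelian varieties of CM type of dimension `≤ 3` are
  STABLY NONDEGENERATE: every power, and every. Declarations: `exists_isIsogeny_biproduct_of_isSimple_of_isOfCMType`,
  `sum_le_sum_comp_of_surjective`, `sum_dim_le_dim_of_isIsogeny_biproduct`,
  `exists_avDominatedBy_powSucc_biproduct_slots`, `isDivisorGenerated_of_avDominatedBy`.
* Part 2 — from `CorCM/CMAlgebraDegreeLeSixNondegenerate` (2/12 declarations; namespace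
  `Literature.AlgebraicGeometry.ComplexMultiplication`): CM algebras of degree `≤ 6`: every PRIMITIVE (separating) CM
  type is NONDEGENERATE — CM abelian varieties of. Declarations: `exists_finrank_eq_two_mul`,
  `finrank_eq_two_mul_dim`.
* Part 3 — from `CorCM/CMAlgebraDegreeLeEightFamilies` (6/11 declarations; namespace
  `Literature.AlgebraicGeometry.ComplexMultiplication`): Simple, pairwise non-isogenous CM abelian varieties of total
  dimension `≤ 4`: the product is stably nondegenerate. Declarations:
  `isEmpty_ringHom_of_finrank_eq_two_of_isPrimitive_quartic`, `dim_add_dim_le_sum`, `dim_add_dim_add_dim_le_sum`,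
  `isNondegenerateFamily_iff_of_isSimple_of_sum_dim_le_four`,
  `hodgeClassSpan_prod_eq_divisorClassesSpan_of_sum_dim_le_four`,
  `exists_exceptional_two_prod_of_dim_one_dim_three_of_ringHom`.

## References

* [MoonenZarhin1999LowDim] B. Moonen, Yu. Zarhin, *Hodge classes on abelian varieties of low dimension*, Math. Ann.
  315 (1999) 711–733, (0.1)–(0.2), §5 (5.1)–(5.2), §2 (2.7).
* [Gordon1999HodgeAVSurvey] B. B. Gordon, *A survey of the Hodge conjecture for abelian varieties*, Thm. 6.4,
  7.4–7.6.1, 10.10.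
* [Milne1999LefschetzClasses] J. S. Milne, *Lefschetz classes on abelian varieties*, Duke Math. J. 96 (1999), §1 Prop.
  1.1 (p. 643).
* [Ribet1980] K. A. Ribet, *Division fields of abelian varieties with complex multiplication*, Mém. SMF 2 (1980), §3
  (3.7).
* [MumfordAV1970] D. Mumford, *Abelian Varieties*, §19 Thm. 1, Cor. 1–2, Remark p. 169.
* [vanGeemen1994HodgeAV] B. van Geemen, *An introduction to the Hodge conjecture for abelian varieties*, §2.4–2.5,
  §3.6.
* [Shimura1998] G. Shimura, *Abelian Varieties with Complex Multiplication and Modular Functions*, §8.2 Prop. 26, §8.4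
  (2).

Provenance: Literature home of the used declarations of the Summits-side modules listed part by part above (cells
`pub-hodge-ring2` / `pub-hodgecm2`; namespaces `Summit.HodgeConjecture.CorCM` re-rooted under
`Literature.AlgebraicGeometry.…` as stated), whose imports are `Literature/` and Mathlib only for the declarations
used; re-homed verbatim (proofs unchanged) so that Literature users are served without importing `Summits/`. Lane
`lit-hodgefound`, seat p20 (generation 34). Theorems only: no definition, no named fact, no `sorry`; axioms `propext`,
`Classical.choice`, `Quot.sound`.
-/

/-! ## Part 1: CMAbelianVarietyDimLeThreePowers -/

noncomputable section

open _root_.CategoryTheory _root_.CategoryTheory.Limits NumberField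
open scoped BigOperators

namespace Literature.AlgebraicGeometry.ComplexMultiplication

open Literature.NumberTheory.ComplexMultiplication
open Literature.AlgebraicGeometry.Motives (AbelianVariety CMType)
open Literature.AlgebraicGeometry.Motives.AbelianVariety
open Literature.AlgebraicGeometry.HodgeTheory
open Literature.AlgebraicGeometry.ComplexMultiplication (IsCMTypeRealisation)
open Literature.AlgebraicGeometry.Milne1999
open Literature.AlgebraicGeometry.Pohlmann1968
open Literature.AlgebraicGeometry.ComplexMultiplication.Domination
open Literature.AlgebraicGeometry.ComplexMultiplication.AndreRiemann

/-! ## §1 Milne's regrouping, refined: simple, pairwise non-isogenous CM representatives -/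

section Regrouping

/-- **Milne's regrouping `A₁^{r₁} × ⋯ × A_s^{r_s} → A` (Duke 1999 Prop. 1.1) with SIMPLE, PAIRWISE NON-ISOGENOUS
representatives**: every complex abelian variety `X` of CM type with `0 < dim X` admits an isogeny
`X ⟶ ⨁ᵢ A'_{cls i}` onto a biproduct of copies of CM REALISATIONS `(A'_c, ι_c, θ_c)` of CM types `(K_c; Φ_c)` of CM
fields, indexed by a finite type `C` (the isogeny classes of the simple factors), every `A'_c` SIMPLE, `A'_c` and
`A'_{c'}` NOT isogenous for `c ≠ c'`, and `cls` SURJECTIVE (every representative occurs).  Same construction as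
`Milne1999.exists_isIsogeny_to_biproduct_of_classes_of_isOfCMType` (Poincaré decomposition into simple CM factors,
a CM-typed model of each simple factor — Deligne 1982 I Prop. 5.1 —, quotient by the isogeny relation,
`Quotient.out` representatives), recording simplicity and non-isogeny instead of `Hom = 0` and commutativity.
[cite: Milne1999LefschetzClasses, §1 Prop. 1.1 (p. 643)] [cite: MumfordAV1970, §19 Thm. 1, Cor. 1 and Cor. 2]
[cite: Deligne1982HodgeCycles, I Prop. 5.1 and §5 (p. 37)] -/
theorem exists_isIsogeny_biproduct_of_isSimple_of_isOfCMType {X : AbelianVariety ℂ} (hX0 : 0 < X.dim)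
    (hCM : IsOfCMType X) :
    ∃ (C : Type) (_ : Fintype C) (K' : C → Type) (_ : ∀ c, Field (K' c)) (_ : ∀ c, NumberField (K' c))
      (_ : ∀ c, IsCMField (K' c)) (Φ' : ∀ c, CMType (K' c)) (A' : C → AbelianVariety ℂ)
      (ι' : ∀ c, 𝓞 (K' c) →+* End (A' c)) (θ' : ∀ c, K' c →+* Module.End ℂ (complexBetti (A' c).X 1))
      (m : ℕ) (cls : Fin (m + 1) → C) (f : X ⟶ ⨁ fun i => A' (cls i)),
      (∀ c, IsCMTypeRealisation (Φ' c) (A' c) (ι' c) (θ' c)) ∧ (∀ c, (A' c).IsSimple) ∧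
      (∀ c c', c ≠ c' → ¬ IsIsogenous (A' c) (A' c')) ∧ Function.Surjective cls ∧ IsIsogeny f := by
  classical
  obtain ⟨m, S, f₀, hS, hf₀⟩ := exists_isIsogeny_to_biproduct_simple_of_isOfCMType hX0 hCM
  -- the isogeny classes of the simple factors
  let r : Setoid (Fin (m + 1)) :=
    { r := fun i j => IsIsogenous (S i) (S j)
      iseqv :=
        { refl := fun i => IsIsogenous.refl (S i)
          symm := fun h => IsIsogenous.symm' h
          trans := fun h h' => h.trans h' } }
  -- a CM-typed model of every simple factor
  have hmodel : ∀ i : Fin (m + 1), ∃ B : AbelianVariety ℂ, IsCMTyped B ∧ IsIsogenous (S i) B :=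
    fun i => exists_isCMTyped_isIsogenous_of_isSimple (S i) (hS i).1 (hS i).2.1 (hS i).2.2
  choose B hBT hSB using hmodel
  have hBdata : ∀ i : Fin (m + 1), ∃ (K : Type) (_ : Field K) (_ : NumberField K) (_ : IsCMField K)
      (Φ : CMType K) (ι : 𝓞 K →+* End (B i)) (θ : K →+* Module.End ℂ (complexBetti (B i).X 1)),
      IsCMTypeRealisation Φ (B i) ι θ := fun i => by
    obtain @⟨K, _, _, _, Φ, _, ι, θ, h⟩ := hBT i
    exact ⟨K, inferInstance, inferInstance, inferInstance, Φ, ι, θ, h⟩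
  choose K iF iN iC Φ ι θ hB using hBdata
  -- classes and representatives
  let C := Quotient r
  let rep : C → Fin (m + 1) := Quotient.out
  have hrep : ∀ i : Fin (m + 1), IsIsogenous (S i) (S (rep (Quotient.mk r i))) := fun i =>
    IsIsogenous.symm' (Quotient.exact (Quotient.out_eq (Quotient.mk r i)) : r.r _ _)
  have hBs : ∀ i, (B i).IsSimple := fun i => (hS i).1.of_isIsogenous (hSB i)
  refine ⟨C, inferInstance, fun c => K (rep c), fun c => iF (rep c), fun c => iN (rep c), fun c => iC (rep c),
    fun c => Φ (rep c), fun c => B (rep c), fun c => ι (rep c), fun c => θ (rep c), m, fun i => Quotient.mk r i,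
    f₀ ≫ biproduct.map fun i => Classical.choose ((hrep i).trans (hSB (rep (Quotient.mk r i)))),
    fun c => hB (rep c), fun c => hBs (rep c), ?_, ?_, ?_⟩
  · -- distinct classes have non-isogenous representatives
    intro c c' hcc' hiso
    refine hcc' ?_
    have h1 : IsIsogenous (S (rep c)) (S (rep c')) :=
      ((hSB (rep c)).trans hiso).trans (IsIsogenous.symm' (hSB (rep c')))
    calc c = Quotient.mk r (rep c) := (Quotient.out_eq c).symm
      _ = Quotient.mk r (rep c') := Quotient.sound h1
      _ = c' := Quotient.out_eq c'
  · -- every class occurs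
    exact fun c => ⟨rep c, Quotient.out_eq c⟩
  · exact isIsogeny_comp hf₀ (isIsogeny_biproduct_map fun i =>
      Classical.choose_spec ((hrep i).trans (hSB (rep (Quotient.mk r i)))))

/-- Bookkeeping: along a SURJECTIVE slot map `cls : J → C`, `Σ_c g c ≤ Σ_j g (cls j)` (every `c` occurs in some
slot; choose a section). [cite: MoonenZarhin1999LowDim, §5 (5.2)] -/
private theorem sum_le_sum_comp_of_surjective {C J : Type} [Fintype C] [Fintype J] {cls : J → C}
    (hcls : Function.Surjective cls) (g : C → ℕ) : ∑ c, g c ≤ ∑ j, g (cls j) := by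
  classical
  obtain ⟨σ, hσ⟩ := hcls.hasRightInverse
  have hinj : Function.Injective σ := hσ.injective
  calc ∑ c, g c = ∑ c, g (cls (σ c)) := Finset.sum_congr rfl fun c _ => by rw [hσ c]
    _ = ∑ j ∈ Finset.univ.image σ, g (cls j) :=
      (Finset.sum_image (f := fun j => g (cls j)) fun x _ y _ h => hinj h).symm
    _ ≤ ∑ j, g (cls j) :=
      Finset.sum_le_sum_of_subset_of_nonneg (Finset.subset_univ _) fun _ _ _ => Nat.zero_le _

/-- **The representatives have total dimension at most `dim X`**: `Σ_c dim A'_c ≤ Σ_i dim A'_{cls i} = dim X`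
(`cls` surjective; the dimension of a biproduct is the sum, and isogenies preserve dimension) — the reduced
dimension of `X` is at most its dimension. [cite: MumfordAV1970, §19] [cite: Gordon1999HodgeAVSurvey, 7.7] -/
theorem sum_dim_le_dim_of_isIsogeny_biproduct {C : Type} [Fintype C] {A' : C → AbelianVariety ℂ}
    {X : AbelianVariety ℂ} {m : ℕ} {cls : Fin (m + 1) → C} {f : X ⟶ ⨁ fun i => A' (cls i)}
    (hcls : Function.Surjective cls) (hf : IsIsogeny f) : ∑ c, (A' c).dim ≤ X.dim :=
  calc ∑ c, (A' c).dim ≤ ∑ i, (A' (cls i)).dim := sum_le_sum_comp_of_surjective hcls fun c => (A' c).dim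
    _ = (⨁ fun i => A' (cls i)).dim := (dim_biproduct_fin _).symm
    _ = X.dim := (dim_eq_of_isIsogeny hf).symm

end Regrouping

/-! ## §2 Powers are isogeny factors of products of the representatives; `B = D` descends along dominations -/

section Domination

/-- **Every power `X^{N+1}` of an isogeny factor `X` of `⨁ᵢ A'_{cls i}` is an isogeny factor of a product
`⨁_{j<n} A'_{π j}` of copies of the `A'_c`** (`X^{N+2} = X^{N+1} × X`, `Domination.AVDominatedBy.prod`,
`(⨁ C₁) × (⨁ C₂) ≅ ⨁ (C₁ ⊔ C₂)` re-indexed by `Fin n ⊕ Fin (m+1) ≃ Fin (n+m+1)`). [cite: MumfordAV1970, §19] -/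
theorem exists_avDominatedBy_powSucc_biproduct_slots {C : Type} (A' : C → AbelianVariety ℂ) {X : AbelianVariety ℂ}
    {m : ℕ} (cls : Fin (m + 1) → C) (hX : AVDominatedBy X (⨁ fun i => A' (cls i))) :
    ∀ N : ℕ, ∃ (n : ℕ) (π : Fin n → C), AVDominatedBy (X.powSucc N) (⨁ fun j => A' (π j))
  | 0 => ⟨m + 1, cls, hX⟩
  | N + 1 => by
    classical
    obtain ⟨n, π, hN⟩ := exists_avDominatedBy_powSucc_biproduct_slots A' cls hX N
    let e : Fin (n + (m + 1)) ≃ Fin n ⊕ Fin (m + 1) := finSumFinEquiv.symm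
    refine ⟨n + (m + 1), fun j => Sum.elim π cls (e j), ?_⟩
    have h := avDominatedBy_biproduct_reindex e (avDominatedBy_prod_of_biproduct hN hX)
    have hfam : (sumFam (fun j => A' (π j)) fun i => A' (cls i)) ∘ e = fun j => A' (Sum.elim π cls (e j)) := by
      funext j
      simp only [Function.comp_apply]
      rcases e j with a | a <;> rfl
    rw [hfam] at h
    rw [powSucc_succ]
    exact h

/-- **`B = D` descends along a domination** `s ≫ π = [N]_A`, `N ≠ 0` (`IsDivisorGenerated.of_comp_eq_nsmul_id`:
`N^{2p} c = s^* π^* c` and `π^* c ∈ Bᵖ(P) = Dᵖ(P) ⊗ ℂ`). [cite: vanGeemen1994HodgeAV, §2.4–2.5 and §3.6–3.7]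
[cite: MumfordAV1970, §19 Remark p. 169] -/
theorem isDivisorGenerated_of_avDominatedBy {A P : AbelianVariety ℂ} (h : AVDominatedBy A P)
    (hP : IsDivisorGenerated P) : IsDivisorGenerated A := by
  obtain ⟨s, π, N, hN, hsπ⟩ := h
  exact IsDivisorGenerated.of_comp_eq_nsmul_id s π hN hsπ hP

end Domination

end Literature.AlgebraicGeometry.ComplexMultiplication

end

/-! ## Part 2: CMAlgebraDegreeLeSixNondegenerate -/

noncomputable section

open _root_.CategoryTheory _root_.CategoryTheory.Limits NumberField
open scoped BigOperators

namespace Literature.AlgebraicGeometry.ComplexMultiplication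

open Literature.NumberTheory.ComplexMultiplication
open Literature.AlgebraicGeometry.Motives (AbelianVariety CMType)
open Literature.AlgebraicGeometry.HodgeTheory
open Literature.AlgebraicGeometry.ComplexMultiplication (IsCMTypeRealisation)
open Literature.AlgebraicGeometry.Pohlmann1968

/-! ## §1 Separating families of total degree `≤ 6` are nondegenerate -/

section TypeLevel

variable {I : Type} {K : I → Type} [∀ i, Field (K i)] [∀ i, NumberField (K i)] [∀ i, IsCMField (K i)] [Fintype I]
  [Nonempty I] {Φ : ∀ i, CMType (K i)}

omit [Fintype I] [Nonempty I] [∀ i, IsCMField (K i)] in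
/-- A field carrying a CM type has even degree `2n ≥ 2` (it is totally complex). [cite: MoonenZarhin1999LowDim, §5 (5.2)] -/
private theorem exists_finrank_eq_two_mul (Φ : ∀ i, CMType (K i)) (i : I) :
    ∃ n : ℕ, 0 < n ∧ Module.finrank ℚ (K i) = 2 * n := by
  haveI := CMTypeLattice.isTotallyComplex_of_cmType (Φ i)
  have hK2 : Module.finrank ℚ (K i) = 2 * InfinitePlace.nrComplexPlaces (K i) := by
    rw [← InfinitePlace.card_add_two_mul_card_eq_rank, IsTotallyComplex.nrRealPlaces_eq_zero, zero_add]
  have hpos : 0 < Module.finrank ℚ (K i) := Module.finrank_pos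
  exact ⟨InfinitePlace.nrComplexPlaces (K i), by omega, hK2⟩

end TypeLevel

/-! ## §2 Realisations: `B = D` and the Hodge conjecture on all products -/

section Geometry

variable {I : Type} {K : I → Type} [∀ i, Field (K i)] [∀ i, NumberField (K i)] [∀ i, IsCMField (K i)] [Fintype I]
  [Nonempty I] {Φ : ∀ i, CMType (K i)}
variable {A : I → AbelianVariety ℂ} {ι : ∀ i, 𝓞 (K i) →+* End (A i)}
  {θ : ∀ i, K i →+* Module.End ℂ (complexBetti (A i).X 1)}

omit [Fintype I] [Nonempty I] [∀ i, IsCMField (K i)] in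
/-- The total degree of the fields is twice the total dimension of the realisations (`dim A_i = [K_i:ℚ]/2`,
`[K_i:ℚ]` even). [cite: Shimura1998, §5.1] -/
theorem finrank_eq_two_mul_dim (hA : ∀ i, IsCMTypeRealisation (Φ i) (A i) (ι i) (θ i)) (i : I) :
    Module.finrank ℚ (K i) = 2 * (A i).dim := by
  obtain ⟨n, -, hn⟩ := exists_finrank_eq_two_mul Φ i
  have hd : (A i).dim = Module.finrank ℚ (K i) / 2 := Literature.AlgebraicGeometry.Motives.schemeDim_eq_holds (hA i).1
  omega

end Geometry

end Literature.AlgebraicGeometry.ComplexMultiplication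

end

/-! ## Part 3: CMAlgebraDegreeLeEightFamilies -/

noncomputable section

open _root_.CategoryTheory _root_.CategoryTheory.Limits NumberField NumberField.ComplexEmbedding IntermediateField Module
open scoped BigOperators

namespace Literature.AlgebraicGeometry.ComplexMultiplication

open Literature.AlgebraicGeometry.ComplexMultiplication.Domination

open Literature.NumberTheory.ComplexMultiplication
open Literature.AlgebraicGeometry.Motives (AbelianVariety CMType)
open Literature.AlgebraicGeometry.Motives.AbelianVariety
open Literature.AlgebraicGeometry.HodgeTheory
open Literature.AlgebraicGeometry.ComplexMultiplication (IsCMTypeRealisation)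
open Literature.AlgebraicGeometry.VanGeemen1994 (hodgeClassSpan)
open Literature.AlgebraicGeometry.Pohlmann1968
open Literature.Barriers.HodgeConjecture (divisorClassesSpan)

/-! ## §1 Fields: an imaginary quadratic field does not embed in a quartic CM field carrying a primitive type -/

section Fields

variable {I : Type} {K : I → Type} [∀ i, Field (K i)] [∀ i, NumberField (K i)] [∀ i, IsCMField (K i)]

/-- **No imaginary quadratic `K_a` embeds in a quartic CM field `K_b` carrying a PRIMITIVE CM type** (`K_b` is then
cyclic or non-Galois, not biquadratic: some `τ ∈ Aut(ℂ)` squares to complex conjugation on `Hom(K_b, ℂ)` —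
seat p2 — which is incompatible with an embedded quadratic field, seat b16 gen 37 `isEmpty_ringHom_of_smul_smul`).
Hence `E × S` is never in Moonen–Zarhin's case (a). [cite: Shimura1998, §8.4 Example (2)]
[cite: MoonenZarhin1999LowDim, §5 (5.2)] -/
theorem isEmpty_ringHom_of_finrank_eq_two_of_isPrimitive_quartic (Φ : ∀ i, CMType (K i)) {a b : I}
    (h2 : finrank ℚ (K a) = 2) (h4 : finrank ℚ (K b) = 4) {φ₀ : K b →+* ℂ}
    (hprim : IsPrimitive (ℂ ≃+* ℂ) (Φ b).1 φ₀) : IsEmpty (K a →+* K b) :=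
  isEmpty_ringHom_of_smul_smul Φ h2 (QuarticCM.exists_ringAut_smul_smul_eq_conjugate_of_isPrimitive h4 hprim)

end Fields

/-! ## §2 The criterion for simple, pairwise non-isogenous CM abelian varieties of total dimension `≤ 4` -/

section Criterion

variable {I : Type} {K : I → Type} [∀ i, Field (K i)] [∀ i, NumberField (K i)] [∀ i, IsCMField (K i)] [Fintype I]
  [DecidableEq I] [Nonempty I] {Φ : ∀ i, CMType (K i)}
variable {A : I → AbelianVariety ℂ} {ι : ∀ i, 𝓞 (K i) →+* End (A i)}
  {θ : ∀ i, K i →+* Module.End ℂ (complexBetti (A i).X 1)}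

omit [DecidableEq I] [Nonempty I] in
/-- Bookkeeping: two distinct slots have total dimension at most `Σ_i dim A_i`. [cite: MoonenZarhin1999LowDim, Thm. (0.1) (4)] -/
private theorem dim_add_dim_le_sum (A : I → AbelianVariety ℂ) {i j : I} (h : i ≠ j) :
    (A i).dim + (A j).dim ≤ ∑ k, (A k).dim := by
  classical
  have h1 := Finset.add_sum_erase Finset.univ (fun k => (A k).dim) (Finset.mem_univ i)
  have h2 : (A j).dim ≤ ∑ k ∈ Finset.univ.erase i, (A k).dim :=
    Finset.single_le_sum (fun k _ => Nat.zero_le ((A k).dim)) (Finset.mem_erase.2 ⟨h.symm, Finset.mem_univ j⟩)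
  omega

omit [DecidableEq I] [Nonempty I] in
/-- Bookkeeping: three pairwise distinct slots have total dimension at most `Σ_i dim A_i`. [cite: MoonenZarhin1999LowDim, Thm. (0.1) (4)] -/
private theorem dim_add_dim_add_dim_le_sum (A : I → AbelianVariety ℂ) {i j l : I} (hij : i ≠ j) (hil : i ≠ l)
    (hjl : j ≠ l) : (A i).dim + (A j).dim + (A l).dim ≤ ∑ k, (A k).dim := by
  classical
  have h1 := Finset.add_sum_erase Finset.univ (fun k => (A k).dim) (Finset.mem_univ i)
  have h2 := Finset.add_sum_erase (Finset.univ.erase i) (fun k => (A k).dim)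
    (Finset.mem_erase.2 ⟨hij.symm, Finset.mem_univ j⟩)
  have h3 : (A l).dim ≤ ∑ k ∈ (Finset.univ.erase i).erase j, (A k).dim :=
    Finset.single_le_sum (fun k _ => Nat.zero_le ((A k).dim))
      (Finset.mem_erase.2 ⟨hjl.symm, Finset.mem_erase.2 ⟨hil.symm, Finset.mem_univ l⟩⟩)
  omega

/-- **MAIN CRITERION (Moonen–Zarhin (0.1), CM case, on CM types).**  Let `A_i` (`i ∈ I`) be SIMPLE, PAIRWISE
NON-ISOGENOUS complex abelian varieties with complex multiplication — realisations of CM types `(K_i; Φ_i)` on `H¹` —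
of total dimension `Σ_i dim A_i ≤ 4`.  Then the family `(Φ_i)_i` is nondegenerate (`rank Hg(∏_i A_i) = Σ_i dim A_i`,
no power of `∏_i A_i` supports an exotic Hodge class) iff
(¬a) for all slots `a ≠ b` with `dim A_a = 1`, `dim A_b = 3` the imaginary quadratic field `K_a` does NOT embed in the
sextic field `K_b`, and (¬b) for every slot with `dim A_b = 4` the (primitive, octic) type `Φ_b` is nondegenerate.
Proof by the dimension multiset: all curves (pairwise non-isomorphic quadratic fields, gen 35); one slot of dimension
`≥ 2` and curves (gen 37's single-big-slot criterion; a quartic slot is nondegenerate by Ribet and admits no embedded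
quadratic field, a sextic slot is nondegenerate by Ribet, an octic slot is alone); two surfaces (seat b23's junction).
[cite: MoonenZarhin1999LowDim, Thm. (0.1) (1), (4) and §5 (5.2)] [cite: Gordon1999HodgeAVSurvey, 7.4–7.5]
[cite: Ribet1980, §3 (3.7)] -/
theorem isNondegenerateFamily_iff_of_isSimple_of_sum_dim_le_four
    (hA : ∀ i, IsCMTypeRealisation (Φ i) (A i) (ι i) (θ i)) (hs : ∀ i, (A i).IsSimple)
    (hniso : ∀ i j, i ≠ j → ¬ AbelianVariety.IsIsogenous (A i) (A j)) (h4 : ∑ i, (A i).dim ≤ 4) :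
    CMAlgebra.IsNondegenerateFamily Φ ↔
      (∀ a b, a ≠ b → (A a).dim = 1 → (A b).dim = 3 → IsEmpty (K a →+* K b)) ∧
        ∀ b, (A b).dim = 4 → IsNondegenerate (Φ b) := by
  classical
  have hsep := CMAlgebra.isSeparatingFamily_of_isSimple_of_pairwise_not_isIsogenous hA hs hniso
  have hdeg : ∀ i, finrank ℚ (K i) = 2 * (A i).dim := finrank_eq_two_mul_dim hA
  have hpos : ∀ i, 0 < (A i).dim := fun i => by
    have h := Module.finrank_pos (R := ℚ) (M := K i)
    rw [hdeg i] at h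
    omega
  have hle : ∀ i, (A i).dim ≤ ∑ j, (A j).dim := fun i =>
    Finset.single_le_sum (fun j _ => Nat.zero_le ((A j).dim)) (Finset.mem_univ i)
  by_cases hall : ∀ i, (A i).dim = 1
  · -- all slots are CM elliptic curves with pairwise non-isomorphic fields
    have h2 : ∀ i, finrank ℚ (K i) = 2 := fun i => by rw [hdeg, hall]
    exact ⟨fun _ => ⟨fun a b _ _ hb => by have := hall b; omega, fun b hb => by have := hall b; omega⟩,
      fun _ => isNondegenerateFamily_of_finrank_eq_two h2 hsep⟩
  push Not at hall
  obtain ⟨i₁, hi₁⟩ := hall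
  have hi₁2 : 2 ≤ (A i₁).dim := by have := hpos i₁; omega
  by_cases huniq : ∀ j, j ≠ i₁ → (A j).dim = 1
  · -- `i₁` is the only slot of dimension `≥ 2`
    have h2 : ∀ j, j ≠ i₁ → finrank ℚ (K j) = 2 := fun j hj => by rw [hdeg, huniq j hj]
    have hχ := exists_not_iff_of_isSeparatingFamily (fun i => i = i₁) Φ h2
      (isSeparatingFamily_subtype hsep fun j => j ≠ i₁)
    rw [isNondegenerateFamily_iff_forall_isEmpty_single i₁ Φ h2 hχ]
    obtain ⟨φ₁⟩ : Nonempty (K i₁ →+* ℂ) := inferInstance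
    have hprim : IsPrimitive (ℂ ≃+* ℂ) (Φ i₁).1 φ₁ := hsep.isPrimitive i₁ φ₁
    rcases (show (A i₁).dim = 2 ∨ (A i₁).dim = 3 ∨ (A i₁).dim = 4 by have := hle i₁; omega) with hd | hd | hd
    · -- a quartic slot and curves: both sides hold
      have h4K : finrank ℚ (K i₁) = 4 := by rw [hdeg, hd]
      have hnd : IsNondegenerate (Φ i₁) := isNondegenerate_of_isPrimitive_of_finrank_le_six (Φ i₁) (by omega) φ₁ hprim
      have hemp : ∀ a, a ≠ i₁ → IsEmpty (K a →+* K i₁) := fun a ha =>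
        isEmpty_ringHom_of_finrank_eq_two_of_isPrimitive_quartic Φ (h2 a ha) h4K hprim
      refine ⟨fun _ => ⟨fun a b _ _ hb => ?_, fun b hb => ?_⟩, fun _ => ⟨hnd, hemp⟩⟩
      · exfalso
        by_cases hb1 : b = i₁
        · rw [hb1] at hb; omega
        · have := huniq b hb1; omega
      · exfalso
        by_cases hb1 : b = i₁
        · rw [hb1] at hb; omega
        · have := huniq b hb1; omega
    · -- a sextic slot and curves: nondegenerate iff no curve field embeds
      have h6K : finrank ℚ (K i₁) = 6 := by rw [hdeg, hd]
      have hnd : IsNondegenerate (Φ i₁) := isNondegenerate_of_isPrimitive_of_finrank_le_six (Φ i₁) (by omega) φ₁ hprim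
      refine ⟨fun h => ⟨fun a b hab _ hb => ?_, fun b hb => ?_⟩, fun h => ⟨hnd, fun a ha => h.1 a i₁ ha (huniq a ha) hd⟩⟩
      · have hb1 : b = i₁ := by
          by_contra hb1
          have := huniq b hb1
          omega
        subst hb1
        exact h.2 a hab
      · exfalso
        by_cases hb1 : b = i₁
        · rw [hb1] at hb; omega
        · have := huniq b hb1; omega
    · -- an octic slot: it is alone
      have hsub : ∀ j, j = i₁ := fun j => by
        by_contra hj
        have h₁ := dim_add_dim_le_sum A hj
        have h₂ := huniq j hj
        omega
      refine ⟨fun h => ⟨fun a b hab _ _ => (hab ((hsub a).trans (hsub b).symm)).elim, fun b _ => ?_⟩,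
        fun h => ⟨h.2 i₁ hd, fun a ha => (ha (hsub a)).elim⟩⟩
      obtain rfl := hsub b
      exact h.1
  · -- a second slot `i₀ ≠ i₁` of dimension `≥ 2`: two simple CM surfaces and nothing else
    push Not at huniq
    obtain ⟨i₀, hi₀, hi₀1⟩ := huniq
    have hi₀2 : 2 ≤ (A i₀).dim := by have := hpos i₀; omega
    have h01 := dim_add_dim_le_sum A hi₀
    have hI : ∀ j, j = i₀ ∨ j = i₁ := fun j => by
      by_contra hj
      push Not at hj
      have h₃ := dim_add_dim_add_dim_le_sum A hj.1 hj.2 hi₀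
      have := hpos j
      omega
    have h4K : ∀ i, finrank ℚ (K i) = 4 := fun i => by
      rcases hI i with rfl | rfl <;> rw [hdeg] <;> omega
    refine ⟨fun _ => ⟨fun a b _ _ hb => ?_, fun b hb => ?_⟩,
      fun _ => isNondegenerateFamily_simpleSurfaces hi₀ hI h4K hA hs hniso⟩
    · exfalso; rcases hI b with rfl | rfl <;> omega
    · exfalso; rcases hI b with rfl | rfl <;> omega

end Criterion

/-! ## §3 Hodge classes on the products: `B• = D•` and the Hodge conjecture, or exceptional classes -/

section Geometry

variable {I : Type} {K : I → Type} [∀ i, Field (K i)] [∀ i, NumberField (K i)] [∀ i, IsCMField (K i)] [Fintype I]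
  [DecidableEq I] [Nonempty I] {Φ : ∀ i, CMType (K i)}
variable {A : I → AbelianVariety ℂ} {ι : ∀ i, 𝓞 (K i) →+* End (A i)}
  {θ : ∀ i, K i →+* Module.End ℂ (complexBetti (A i).X 1)}

/-- **`Bᵐ ⊗ ℂ = Dᵐ ⊗ ℂ` on every `∏_i A_i^{k_i}`** (every `⨁_{j<N} A_{π j}`) for simple, pairwise non-isogenous CM
abelian varieties of total dimension `≤ 4` satisfying (¬a) ∧ (¬b) (Moonen–Zarhin (0.1) (4), CM case: no power and no
product of powers supports an exotic Hodge class). [cite: MoonenZarhin1999LowDim, Thm. (0.1) (4)]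
[cite: Gordon1999HodgeAVSurvey, 7.5] -/
theorem hodgeClassSpan_prod_eq_divisorClassesSpan_of_sum_dim_le_four
    (hA : ∀ i, IsCMTypeRealisation (Φ i) (A i) (ι i) (θ i)) (hs : ∀ i, (A i).IsSimple)
    (hniso : ∀ i j, i ≠ j → ¬ AbelianVariety.IsIsogenous (A i) (A j)) (h4 : ∑ i, (A i).dim ≤ 4)
    (hfor : ∀ a b, a ≠ b → (A a).dim = 1 → (A b).dim = 3 → IsEmpty (K a →+* K b))
    (hoct : ∀ b, (A b).dim = 4 → IsNondegenerate (Φ b)) {N : ℕ} (π : Fin N → I) (m : ℕ) :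
    hodgeClassSpan (⨁ fun j : Fin N => A (π j)).dim (⨁ fun j : Fin N => A (π j)).X m =
      divisorClassesSpan (⨁ fun j : Fin N => A (π j)).X (⨁ fun j : Fin N => A (π j)).dim m :=
  ((isNondegenerateFamily_iff_of_isSimple_of_sum_dim_le_four hA hs hniso h4).2 ⟨hfor, hoct⟩)
    |>.hodgeClassSpan_prod_eq_divisorClassesSpan hA π m

omit [DecidableEq I] [Nonempty I] in
/-- **Case (a), sharp placement: a curve field embedded in the field of a threefold puts a rational `(2,2)`-class
OUTSIDE `D² ⊗ ℂ` on every product containing both** (a Weil class of `k = K_a`; seat b16 gen 37's Weil fibre), for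
simple, pairwise non-isogenous factors — "the Weil classes are really needed … `D²(X) ≠ B²(X)`".
[cite: MoonenZarhin1999LowDim, Thm. (0.1) (a), (1) and (1.9)] [cite: Gordon1999HodgeAVSurvey, 9.2] -/
theorem exists_exceptional_two_prod_of_dim_one_dim_three_of_ringHom
    (hA : ∀ i, IsCMTypeRealisation (Φ i) (A i) (ι i) (θ i)) (hs : ∀ i, (A i).IsSimple)
    (hniso : ∀ i j, i ≠ j → ¬ AbelianVariety.IsIsogenous (A i) (A j)) {N : ℕ} (π : Fin N → I) {j₀ j₁ : Fin N}
    (h1 : (A (π j₀)).dim = 1) (h3 : (A (π j₁)).dim = 3) (e : K (π j₀) →+* K (π j₁)) :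
    ∃ c : complexBetti (⨁ fun j : Fin N => A (π j)).X (2 * 2), IsRationalClass c ∧
      IsOfHodgeType (⨁ fun j : Fin N => A (π j)).dim (⨁ fun j : Fin N => A (π j)).X (2 * 2) 2 2 c ∧
      c ∉ divisorClassesSpan (⨁ fun j : Fin N => A (π j)).X (⨁ fun j : Fin N => A (π j)).dim 2 := by
  have hsep := CMAlgebra.isSeparatingFamily_of_isSimple_of_pairwise_not_isIsogenous hA hs hniso
  have h2 : finrank ℚ (K (π j₀)) = 2 := by rw [finrank_eq_two_mul_dim hA, h1]
  have h6 : finrank ℚ (K (π j₁)) = 6 := by rw [finrank_eq_two_mul_dim hA, h3]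
  obtain ⟨φ₁⟩ : Nonempty (K (π j₁) →+* ℂ) := inferInstance
  exact exists_exceptional_two_prod_of_ringHom hsep hA π h2 h6
    (isNondegenerate_of_isPrimitive_of_finrank_le_six (Φ (π j₁)) (by omega) φ₁ (hsep.isPrimitive (π j₁) φ₁)) e

end Geometry

end Literature.AlgebraicGeometry.ComplexMultiplication

end
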